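import Mathlib.Analysis.Calculus.MeanValue
import Mathlib.Analysis.Calculus.ContDiff.Basic
import Mathlib.Analysis.Calculus.ContDiff.Operations
import Mathlib.Analysis.SpecialFunctions.Pow.NNReal
import Literature.Analysis.FunctionSpaces.HolderNorm
import HarnessLib

/-!
# Hölder seminorms by interpolation, and `C^{k,α}` norms of rescaled functions

Trunk: Sobolev (`Literature/Analysis/FunctionSpaces`). Elementary tools for the scaling analysis
of (quasi-)self-similar constructions (Alberti–Crippa–Mazzucato 2019, Lemma 18 and Rem. 20
(iii): `‖u(t)‖_{Ẇ^{r,∞}} ≤ C_r (λ^{1-r})^t`, proved for integer `r` by the chain rule under the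
rescaling `x ↦ λ⁻ⁿ(x - r_Q)` and for fractional `r` by interpolation; Bruè–De Lellis 2023,
Thm. 4.1 (a): `‖∂ₜ^k v_n‖_{C^α} ≤ C(α,k) 5^{(α-1)n}`):

* `holderWith_of_lipschitzWith_of_edist_le` — **interpolation at scale `δ`**: an `L`-Lipschitz
  map with oscillation `≤ B` is `r`-Hölder with constant `L δ^{1-r} + B δ^{-r}` for every
  `r ≤ 1` and `δ > 0` (small increments by the Lipschitz bound, large ones by the oscillation);
* `eContDiffHolderNorm_le_of_norm_iteratedFDeriv_le` — the `C^{k,r}` norm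
  (`eContDiffHolderNorm k r`, `∑_{i ≤ k} ‖Dⁱf‖_∞ + [Dᵏf]_r`) of a `C^{k+1}` map with
  `‖Dⁱ f‖ ≤ Mᵢ`, `i ≤ k+1`, is at most `Σ_{i ≤ k} Mᵢ + M_{k+1} δ^{1-r} + 2 M_k δ^{-r}`;
* `norm_iteratedFDeriv_rescale_le` — for `g(y) = c • G(a • y - b)`,
  `‖Dⁱ g(y)‖ ≤ |c| |a|ⁱ ‖Dⁱ G(a • y - b)‖` (chain rule with the homothety `a • id`);
* `norm_le_of_dense_of_continuous` — a bound for a continuous map on a dense set holds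
  everywhere (used to pass cellwise bounds to the cell interfaces).

## References

* G. Alberti, G. Crippa, A. L. Mazzucato, *Exponential self-similar mixing by incompressible
  flows*, J. Amer. Math. Soc. 32 (2019), Lemma 18 (scaling of `Ẇ^{k,p}` norms, Step 1, and
  interpolation, Step 2), Rem. 20 (iii).
* E. Bruè, C. De Lellis, *Anomalous dissipation for the forced 3D Navier–Stokes equations*,
  Comm. Math. Phys. 400 (2023), Thm. 4.1 (a).
* D. Gilbarg, N. Trudinger, *Elliptic PDE of Second Order* (2001), §4.1 (the norms
  `|u|_{k,α}`), (6.8)–(6.9) (interpolation of Hölder seminorms).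
-/

noncomputable section

open Set Filter
open scoped NNReal ENNReal Topology

namespace Literature.Analysis.FunctionSpaces

/-! ## Interpolation: Hölder constants from a Lipschitz bound and an oscillation bound -/

section Interpolation

variable {X Y : Type*} [PseudoEMetricSpace X] [PseudoEMetricSpace Y]

/-- **Interpolation at scale `δ`.** If `f` is `L`-Lipschitz and has oscillation at most `B`
(`edist (f x) (f y) ≤ B` for all `x, y`), then for every exponent `r ≤ 1` and every scale
`δ > 0`, `f` is `r`-Hölder with constant `L δ^{1-r} + B δ^{-r}`: increments over distances
`≤ δ` are bounded by `L d = L d^{1-r} d^r ≤ L δ^{1-r} d^r`, the others by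
`B = B δ^{-r} δ^r ≤ B δ^{-r} d^r` (Gilbarg–Trudinger 2001, (6.8)–(6.9); the form used in the
scaling analysis of Alberti–Crippa–Mazzucato 2019, Lemma 18, Step 2). [folklore] -/
theorem holderWith_of_lipschitzWith_of_edist_le {f : X → Y} {L B : ℝ≥0} (hL : LipschitzWith L f)
    (hB : ∀ x y, edist (f x) (f y) ≤ B) {r : ℝ≥0} (hr : r ≤ 1) {δ : ℝ≥0} (hδ : 0 < δ) :
    HolderWith (L * δ ^ (1 - r : ℝ) + B * δ⁻¹ ^ (r : ℝ)) r f := by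
  intro x y
  have hr0 : (0 : ℝ) ≤ r := r.2
  have h1r : (0 : ℝ) ≤ 1 - r := by
    have : (r : ℝ) ≤ 1 := by exact_mod_cast hr
    linarith
  have hδ0 : (δ : ℝ≥0∞) ≠ 0 := by exact_mod_cast hδ.ne'
  have hδt : (δ : ℝ≥0∞) ≠ ∞ := ENNReal.coe_ne_top
  have hcoe : ((L * δ ^ (1 - r : ℝ) + B * δ⁻¹ ^ (r : ℝ) : ℝ≥0) : ℝ≥0∞) =
      (L : ℝ≥0∞) * (δ : ℝ≥0∞) ^ (1 - r : ℝ) + (B : ℝ≥0∞) * (δ : ℝ≥0∞)⁻¹ ^ (r : ℝ) := by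
    rw [ENNReal.coe_add, ENNReal.coe_mul, ENNReal.coe_mul, ENNReal.coe_rpow_of_nonneg _ h1r,
      ENNReal.coe_rpow_of_nonneg _ hr0, ENNReal.coe_inv hδ.ne']
  rw [hcoe]
  set e := edist x y with he
  rcases le_or_gt e δ with hle | hgt
  · -- small increments: Lipschitz bound
    calc edist (f x) (f y) ≤ L * e := hL x y
      _ = L * (e ^ (1 - r : ℝ) * e ^ (r : ℝ)) := by
          rw [← ENNReal.rpow_add_of_nonneg _ _ h1r hr0, sub_add_cancel, ENNReal.rpow_one]
      _ ≤ L * ((δ : ℝ≥0∞) ^ (1 - r : ℝ) * e ^ (r : ℝ)) := by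
          gcongr
      _ = (L : ℝ≥0∞) * (δ : ℝ≥0∞) ^ (1 - r : ℝ) * e ^ (r : ℝ) := by ring
      _ ≤ ((L : ℝ≥0∞) * (δ : ℝ≥0∞) ^ (1 - r : ℝ) + (B : ℝ≥0∞) * (δ : ℝ≥0∞)⁻¹ ^ (r : ℝ)) *
            e ^ (r : ℝ) := by
          gcongr
          exact le_self_add
  · -- large increments: oscillation bound
    have hone : (δ : ℝ≥0∞)⁻¹ ^ (r : ℝ) * (δ : ℝ≥0∞) ^ (r : ℝ) = 1 := by
      rw [← ENNReal.mul_rpow_of_nonneg _ _ hr0, ENNReal.inv_mul_cancel hδ0 hδt, ENNReal.one_rpow]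
    calc edist (f x) (f y) ≤ B := hB x y
      _ = B * ((δ : ℝ≥0∞)⁻¹ ^ (r : ℝ) * (δ : ℝ≥0∞) ^ (r : ℝ)) := by rw [hone, mul_one]
      _ ≤ B * ((δ : ℝ≥0∞)⁻¹ ^ (r : ℝ) * e ^ (r : ℝ)) := by
          gcongr
      _ = (B : ℝ≥0∞) * (δ : ℝ≥0∞)⁻¹ ^ (r : ℝ) * e ^ (r : ℝ) := by ring
      _ ≤ ((L : ℝ≥0∞) * (δ : ℝ≥0∞) ^ (1 - r : ℝ) + (B : ℝ≥0∞) * (δ : ℝ≥0∞)⁻¹ ^ (r : ℝ)) *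
            e ^ (r : ℝ) := by
          gcongr
          exact le_add_self

end Interpolation

/-! ## Bounds on a dense set -/

section Dense

variable {X Y : Type*} [TopologicalSpace X] [SeminormedAddCommGroup Y]

/-- A norm bound for a continuous map on a dense set holds everywhere (the sublevel set is
closed). [folklore] -/
theorem norm_le_of_dense_of_continuous {g : X → Y} (hg : Continuous g) {s : Set X} (hs : Dense s)
    {M : ℝ} (h : ∀ x ∈ s, ‖g x‖ ≤ M) (x : X) : ‖g x‖ ≤ M := by
  have hclosed : IsClosed {x | ‖g x‖ ≤ M} := isClosed_le hg.norm continuous_const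
  have hsub : closure s ⊆ {x | ‖g x‖ ≤ M} := hclosed.closure_subset_iff.2 h
  exact hsub (hs.closure_eq ▸ mem_univ x)

end Dense

/-! ## `C^{k,r}` norms from derivative bounds -/

section ContDiffHolder

variable {E' : Type*} [NormedAddCommGroup E'] [NormedSpace ℝ E'] {Y : Type*}
  [NormedAddCommGroup Y] [NormedSpace ℝ Y]

omit [NormedSpace ℝ Y] in
/-- Pointwise bounds give sup-norm bounds: `‖g x‖ ≤ M` for all `x` implies `‖g‖_∞ ≤ M`
(`eSupNorm`). [folklore] -/
theorem eSupNorm_le_ofReal {X : Type*} {g : X → Y} {M : ℝ} (h : ∀ x, ‖g x‖ ≤ M) :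
    eSupNorm g ≤ ENNReal.ofReal M :=
  iSup_le fun x => by
    rw [← ofReal_norm]
    exact ENNReal.ofReal_le_ofReal (h x)

/-- **The `C^{k,r}` norm from derivative bounds.** If `f` is `C^{k+1}` with
`‖Dⁱ f(x)‖ ≤ Mᵢ` for all `x` and `i ≤ k + 1` (`Mᵢ ≥ 0`), then for every `r ≤ 1` and `δ > 0`,
`‖f‖_{C^{k,r}} = Σ_{i ≤ k} ‖Dⁱ f‖_∞ + [Dᵏ f]_r ≤ Σ_{i ≤ k} Mᵢ + M_{k+1} δ^{1-r} + 2 M_k δ^{-r}`: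
the top derivative `Dᵏ f` is `M_{k+1}`-Lipschitz (mean value inequality,
`‖D(Dᵏf)‖ = ‖D^{k+1} f‖`) with oscillation `≤ 2 M_k`, so
`holderWith_of_lipschitzWith_of_edist_le` applies (Alberti–Crippa–Mazzucato 2019, Lemma 18;
Gilbarg–Trudinger 2001, §4.1). [folklore] -/
theorem eContDiffHolderNorm_le_of_norm_iteratedFDeriv_le {f : E' → Y} {k : ℕ}
    (hf : ContDiff ℝ (k + 1) f) {M : ℕ → ℝ} (hM0 : ∀ i, 0 ≤ M i)
    (hM : ∀ i ≤ k + 1, ∀ x, ‖iteratedFDeriv ℝ i f x‖ ≤ M i) {r : ℝ≥0} (hr : r ≤ 1) {δ : ℝ}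
    (hδ : 0 < δ) :
    eContDiffHolderNorm k r f ≤ ENNReal.ofReal ((∑ i ∈ Finset.range (k + 1), M i) +
      (M (k + 1) * δ ^ (1 - r : ℝ) + 2 * M k * δ⁻¹ ^ (r : ℝ))) := by
  have hr0 : (0 : ℝ) ≤ r := r.2
  have h1r : (0 : ℝ) ≤ 1 - r := by
    have : (r : ℝ) ≤ 1 := by exact_mod_cast hr
    linarith
  -- the sup norms
  have hsup : ∑ i ∈ Finset.range (k + 1), eSupNorm (iteratedFDeriv ℝ i f) ≤
      ENNReal.ofReal (∑ i ∈ Finset.range (k + 1), M i) := by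
    rw [ENNReal.ofReal_sum_of_nonneg fun i _ => hM0 i]
    refine Finset.sum_le_sum fun i hi => eSupNorm_le_ofReal (hM i ?_)
    have := Finset.mem_range.1 hi
    omega
  -- the Hölder seminorm of the top derivative
  set g : E' → E' [×k]→L[ℝ] Y := iteratedFDeriv ℝ k f with hg
  have hgd : Differentiable ℝ g := hf.differentiable_iteratedFDeriv (by exact_mod_cast Nat.lt_succ_self k)
  have hLip : LipschitzWith (M (k + 1)).toNNReal g := by
    refine lipschitzWith_of_nnnorm_fderiv_le hgd fun x => ?_
    rw [← NNReal.coe_le_coe, coe_nnnorm, Real.coe_toNNReal _ (hM0 _), hg, norm_fderiv_iteratedFDeriv]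
    exact hM (k + 1) le_rfl x
  have hosc : ∀ x y, edist (g x) (g y) ≤ (2 * M k).toNNReal := by
    intro x y
    rw [edist_eq_enorm_sub, ← ofReal_norm, ← ENNReal.ofReal_coe_nnreal,
      Real.coe_toNNReal _ (by linarith [hM0 k])]
    refine ENNReal.ofReal_le_ofReal ?_
    calc ‖g x - g y‖ ≤ ‖g x‖ + ‖g y‖ := norm_sub_le _ _
      _ ≤ M k + M k := add_le_add (hM k (Nat.le_succ k) x) (hM k (Nat.le_succ k) y)
      _ = 2 * M k := by ring
  have hδ' : (0 : ℝ≥0) < δ.toNNReal := Real.toNNReal_pos.2 hδ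
  have hH := (holderWith_of_lipschitzWith_of_edist_le hLip hosc hr hδ').eHolderNorm_le
  have hHreal : eHolderNorm r g ≤
      ENNReal.ofReal (M (k + 1) * δ ^ (1 - r : ℝ) + 2 * M k * δ⁻¹ ^ (r : ℝ)) := by
    refine hH.trans (le_of_eq ?_)
    rw [← ENNReal.ofReal_coe_nnreal]
    congr 1
    rw [NNReal.coe_add, NNReal.coe_mul, NNReal.coe_mul, NNReal.coe_rpow, NNReal.coe_rpow,
      NNReal.coe_inv, Real.coe_toNNReal _ (hM0 _),
      Real.coe_toNNReal (2 * M k) (by linarith [hM0 k]), Real.coe_toNNReal _ hδ.le]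
  -- assemble
  rw [eContDiffHolderNorm, ENNReal.ofReal_add (Finset.sum_nonneg fun i _ => hM0 i)
    (add_nonneg (mul_nonneg (hM0 _) (Real.rpow_nonneg hδ.le _))
      (mul_nonneg (mul_nonneg zero_le_two (hM0 k)) (Real.rpow_nonneg (inv_nonneg.2 hδ.le) _)))]
  exact add_le_add hsup hHreal

/-- **Derivatives of a rescaled function.** For `G ∈ Cⁿ`, real `a, c`, a vector `b` and
`g(y) = c • G(a • y - b)`: `‖Dⁱ g(y)‖ ≤ |c| |a|ⁱ ‖Dⁱ G(a • y - b)‖` for `i ≤ n` (chain rule with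
the homothety `a • id`, `ContinuousLinearMap.iteratedFDeriv_comp_right`, and
`‖(DⁱG) ∘ (a • id)^{⊗ i}‖ ≤ ‖DⁱG‖ |a|ⁱ`). This is the computation behind
`‖∇ᵏ (λ u(x/λ))‖ = λ^{1-k} ‖(∇ᵏ u)(x/λ)‖` (Alberti–Crippa–Mazzucato 2019, §2.4
"Scaling properties", `‖f_λ‖_{Ẇ^{s,∞}} = λ^{-s} ‖f‖_{Ẇ^{s,∞}}`, and proof of Lemma 18, Step 1).
[folklore] -/
theorem norm_iteratedFDeriv_rescale_le {G : E' → Y} {n : ℕ} (hG : ContDiff ℝ n G) (c a : ℝ)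
    (b : E') {i : ℕ} (hi : i ≤ n) (y : E') :
    ‖iteratedFDeriv ℝ i (fun y => c • G (a • y - b)) y‖ ≤
      |c| * |a| ^ i * ‖iteratedFDeriv ℝ i G (a • y - b)‖ := by
  set L : E' →L[ℝ] E' := a • ContinuousLinearMap.id ℝ E' with hL
  set G' : E' → Y := fun z => G (z - b) with hG'
  have hG'c : ContDiff ℝ n G' := hG.comp (contDiff_id.sub contDiff_const)
  have hcomp : (fun y => G (a • y - b)) = G' ∘ L := by
    funext y; simp [hG', hL]
  have h1 : iteratedFDeriv ℝ i (fun y => c • G (a • y - b)) y =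
      c • iteratedFDeriv ℝ i (G' ∘ L) y := by
    rw [← hcomp]
    exact iteratedFDeriv_const_smul_apply' (((hcomp ▸ hG'c.comp L.contDiff).of_le
      (by exact_mod_cast hi)).contDiffAt)
  have h2 : iteratedFDeriv ℝ i (G' ∘ L) y =
      (iteratedFDeriv ℝ i G' (L y)).compContinuousLinearMap fun _ => L :=
    L.iteratedFDeriv_comp_right hG'c y (by exact_mod_cast hi)
  have h3 : iteratedFDeriv ℝ i G' (L y) = iteratedFDeriv ℝ i G (a • y - b) := by
    rw [hG', iteratedFDeriv_comp_sub]
    simp [hL]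
  have hLnorm : ‖L‖ ≤ |a| := by
    rw [hL]
    refine (norm_smul_le a (ContinuousLinearMap.id ℝ E')).trans ?_
    rw [Real.norm_eq_abs]
    exact mul_le_of_le_one_right (abs_nonneg a) ContinuousLinearMap.norm_id_le
  rw [h1, norm_smul, Real.norm_eq_abs, h2, mul_assoc]
  gcongr
  refine (ContinuousMultilinearMap.norm_compContinuousLinearMap_le _ _).trans ?_
  rw [h3, Finset.prod_const, Finset.card_univ, Fintype.card_fin, mul_comm]
  gcongr

end ContDiffHolder

end Literature.Analysis.FunctionSpaces
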